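import Summits.CriticalPhenomena.CardyFormulaZ2.Theorems.CardyFlipRussoVoronoiHubFromSmirnovDefs
import Literature.Analysis.Complex.LengthArea

/-!
# Change of variables for the transported intensity (S3a brick of the line
# `moebius-exact-delaunay-dilation-ward`, crux `VoronoiHubFromSmirnov`, stmt-CriticalPhenomena-6433)

Helper file (`--supports stmt-CriticalPhenomena-6433`) proving the registered stub
`map_transport_intensity_eq` of the checked skeleton: the push-forward of the inhomogeneous
intensity `ρ(δ b) db` (profile `ρ = ‖h′‖²` on the open set `V`), restricted to the configuration-
coordinate window `V/δ = {b | δ b ∈ V}`, under the transport map `g b = h (δ b) / δ` is Lebesgue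
measure restricted to `g (V/δ) = h(V)/δ`.  This is Mathlib's change of variables
`MeasureTheory.map_withDensity_abs_det_fderiv_eq_addHaar` once one knows that the real Jacobian
determinant of the real-linear map `z ↦ a z` (`a ∈ ℂ`) is `‖a‖ ^ 2`
(`Literature.Analysis.Complex.LengthArea.det_restrictScalars_smulRight`) and that
`deriv g b = deriv h (δ b)` (chain rule).

Source: I. Benjamini, O. Schramm, *Conformal invariance of Voronoi percolation*, Comm. Math. Phys.
197 (1998) 75–107, §3 (the mapping step of Thm 2.1); J. F. C. Kingman, *Poisson Processes* (OUP 1993),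
§2.3 Mapping Theorem.
-/

noncomputable section

namespace Summit.CriticalPhenomena.CardyFormulaZ2.Cruxes.VoronoiHubFromSmirnov.MoebiusExactDelaunayDilationWard

open scoped Topology ENNReal
open Filter Set MeasureTheory
open Literature.Analysis.FunctionSpaces
open Literature.Probability.RandomPlanarGeometry

/-- The transport map `b ↦ h (δ b) / δ` has complex derivative `deriv h (δ b)` at every `b` with
`δ b ∈ V` (`V` open, `h` holomorphic on `V`, `δ ≠ 0`): chain rule, `δ · h′(δ b) · δ⁻¹`. -/
theorem mti_hasDerivAt_transport {h : ℂ → ℂ} {V : Set ℂ} {δ : ℝ} (hV : IsOpen V)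
    (hd : DifferentiableOn ℂ h V) (hδ : (δ : ℂ) ≠ 0) {b : ℂ} (hb : (δ : ℂ) * b ∈ V) :
    HasDerivAt (fun b : ℂ => h ((δ : ℂ) * b) / (δ : ℂ)) (deriv h ((δ : ℂ) * b)) b := by
  have h1 : HasDerivAt h (deriv h ((δ : ℂ) * b)) ((δ : ℂ) * b) :=
    (hd.differentiableAt (hV.mem_nhds hb)).hasDerivAt
  have h2 : HasDerivAt (fun b : ℂ => (δ : ℂ) * b) ((δ : ℂ) * 1) b :=
    (hasDerivAt_id b).const_mul (δ : ℂ)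
  have h3 := (h1.comp b h2).div_const (δ : ℂ)
  have h4 : deriv h ((δ : ℂ) * b) * ((δ : ℂ) * 1) / (δ : ℂ) = deriv h ((δ : ℂ) * b) := by
    field_simp
  rw [h4] at h3
  exact h3

/-- The transport map `b ↦ h (δ b) / δ` is injective on `{b | δ b ∈ V}` when `h` is injective on
`V` and `δ ≠ 0`. -/
theorem mti_injOn_transport {h : ℂ → ℂ} {V : Set ℂ} {δ : ℝ} (hi : InjOn h V)
    (hδ : (δ : ℂ) ≠ 0) :
    InjOn (fun b : ℂ => h ((δ : ℂ) * b) / (δ : ℂ)) {b : ℂ | (δ : ℂ) * b ∈ V} := by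
  intro b₁ hb₁ b₂ hb₂ heq
  have h1 : h ((δ : ℂ) * b₁) = h ((δ : ℂ) * b₂) := (div_left_inj' hδ).mp heq
  have h2 : (δ : ℂ) * b₁ = (δ : ℂ) * b₂ := hi hb₁ hb₂ h1
  exact mul_left_cancel₀ hδ h2

/-- On the window `{b | δ b ∈ V}` the intensity `intensity ρ 1 δ` (density `ρ(δ b)`, with
`ρ = ‖h′‖²` on `V`) is Lebesgue measure with density the absolute real Jacobian determinant of the
transport map `b ↦ h (δ b) / δ`. -/
theorem mti_intensity_restrict_eq {h : ℂ → ℂ} {V : Set ℂ} {ρ : ℂ → ℝ} {δ : ℝ}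
    (hs : MeasurableSet {b : ℂ | (δ : ℂ) * b ∈ V}) (hρ : ∀ z ∈ V, ρ z = ‖deriv h z‖ ^ 2) :
    (intensity ρ 1 δ).restrict {b : ℂ | (δ : ℂ) * b ∈ V} =
      ((volume : Measure ℂ).restrict {b : ℂ | (δ : ℂ) * b ∈ V}).withDensity fun b =>
        ENNReal.ofReal |(((ContinuousLinearMap.smulRight (1 : ℂ →L[ℂ] ℂ)
          (deriv h ((δ : ℂ) * b))).restrictScalars ℝ)).det| := by
  unfold intensity
  rw [restrict_withDensity hs]
  refine withDensity_congr_ae (ae_restrict_of_forall_mem hs fun b hb => ?_)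
  dsimp only
  rw [Literature.Analysis.Complex.LengthArea.det_restrictScalars_smulRight,
    abs_of_nonneg (by positivity), densityPath, hρ _ hb]
  ring_nf

/-- **S3a brick — change of variables for the transported intensity.**  For `h` holomorphic and
injective on the open set `V`, `δ > 0` and a profile `ρ = ‖h′‖²` on `V`, the push-forward of the
inhomogeneous intensity `intensity ρ 1 δ` (density `ρ(δ b) db` in configuration coordinates)
restricted to `{b | δ b ∈ V}` under the transport map `b ↦ h (δ b) / δ` is Lebesgue measure
restricted to the image `h(V)/δ`: the real Jacobian of `b ↦ h(δ b)/δ` is `‖h′(δ b)‖² = ρ(δ b)`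
(Benjamini–Schramm 1998 §3; Kingman's Mapping Theorem input). -/
theorem map_transport_intensity_eq : ∀ (h : ℂ → ℂ) (V : Set ℂ) (ρ : ℂ → ℝ) (δ : ℝ), IsOpen V → DifferentiableOn ℂ h V → Set.InjOn h V → Measurable h → 0 < δ → (∀ z ∈ V, ρ z = ‖deriv h z‖ ^ 2) → MeasureTheory.Measure.map (fun b : ℂ => h ((δ : ℂ) * b) / (δ : ℂ)) ((intensity ρ 1 δ).restrict {b : ℂ | (δ : ℂ) * b ∈ V}) = (MeasureTheory.volume : MeasureTheory.Measure ℂ).restrict ((fun b : ℂ => h ((δ : ℂ) * b) / (δ : ℂ)) '' {b : ℂ | (δ : ℂ) * b ∈ V}) := by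
  intro h V ρ δ hV hd hi _ hδ hρ
  have hδ' : (δ : ℂ) ≠ 0 := Complex.ofReal_ne_zero.mpr hδ.ne'
  have hs : MeasurableSet {b : ℂ | (δ : ℂ) * b ∈ V} :=
    (hV.preimage (by fun_prop : Continuous fun b : ℂ => (δ : ℂ) * b)).measurableSet
  have hf' : ∀ b ∈ {b : ℂ | (δ : ℂ) * b ∈ V}, HasFDerivWithinAt
      (fun b : ℂ => h ((δ : ℂ) * b) / (δ : ℂ))
      ((ContinuousLinearMap.smulRight (1 : ℂ →L[ℂ] ℂ) (deriv h ((δ : ℂ) * b))).restrictScalars ℝ)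
      {b : ℂ | (δ : ℂ) * b ∈ V} b := fun b hb =>
    ((mti_hasDerivAt_transport hV hd hδ' hb).hasFDerivAt.restrictScalars ℝ).hasFDerivWithinAt
  rw [mti_intensity_restrict_eq hs hρ]
  exact map_withDensity_abs_det_fderiv_eq_addHaar volume hs.nullMeasurableSet hf'
    (mti_injOn_transport hi hδ')

end Summit.CriticalPhenomena.CardyFormulaZ2.Cruxes.VoronoiHubFromSmirnov.MoebiusExactDelaunayDilationWard

end
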